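/-
Copyright (c) 2026. All rights reserved.
Released under Apache 2.0 license as described in the file LICENSE.
Authors: abc-iut cell — seat abc-iut-w6-d024 (gen 4; block C / W6, L4-lead RULING #8f row «COR27f-AT-MODEL»):
PROOF-ONLY — no definitions.  Cross-references: abc-iut-w5-d208 «COR27f-DEG1» (degree sub-case of (f)),
abc-iut-w6-d031 ((f) at the 𝔼-level group law); disjoint from both.
-/
import Literature.AnabelianGeometry.AbsoluteAnabelian.ArchimedeanReconstructionCor27eGermAutFromAutHolProofs
import HarnessLib

/-!
# [AbsTopIII] Cor 2.7 (f) at the germ model: the frames of (d) and the groups `𝒜_p` of (e) are carried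
# along a holomorphic local isomorphism by its derivative — "same multiplier"

S. Mochizuki, *Topics in absolute anabelian geometry III* (bib key `MochizukiAbsTopIII2015`), Cor 2.7,
kurims p.60 l.15–16: "Finally, the asserted 'functoriality' is with respect to finite étale morphisms of
Aut-holomorphic orbispaces arising from hyperbolic orbicurves over `ℂ`" — for the outputs of (d) (orthogonal
frames) and (e) (the groups `𝒜_p` with their field structures `𝒜_p ∪ {0}`).

A finite étale morphism is, near each point, a holomorphic local isomorphism `φ` with `φ'(p) ≠ 0`; read in
the plane it induces NO homomorphism `Aut^hol(V) → Aut^hol(V')` (one-parameter subgroups do not push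
forward), so the functoriality of the (d)-frames `autHolOrthFramesAt V p` (abc-iut-w6-d024, p437330:
tangent-vector pairs of orbits `S₁ · p`, `(k S₁ k⁻¹) · p` read off `𝒜_𝕍(V^top) = Aut^hol(V)` alone) is NOT
formal.  It follows from the CHARACTERISATION proved in `…Cor27eGermAutFromAutHolProofs.lean` (p440390):

* `Cor27e.zero_mem_autHolOrthFramesAt`, `Cor27e.mem_autHolOrthFramesAt_iff` — at every point of every
  planar Aut-holomorphic disc the frames of (d) are EXACTLY `{(0, 0)} ∪ {non-zero orthogonal pairs}`;
* `Cor27f.image_mul_autHolOrthFramesAt` — hence ANY complex similarity `e ↦ (c e₁, c e₂)`, `c ≠ 0`, maps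
  the frames of (d) at `(V, p)` ONTO those at `(V', p')`, for any two discs and points;
* `Cor27f.autHolOrthFramesAt_transport_of_hasDerivAt` — in particular the derivative `φ'(p) ·` of a map
  with `HasDerivAt φ d p`, `d ≠ 0` (a holomorphic finite étale map / local isomorphism read in the plane)
  carries the frames at `p` onto the frames at `φ p`: **(d) is functorial along finite étale maps**;
* `Cor27f.mem_germAutFromAutHol_iff`, `Cor27f.mulUnit_mem_germAutFromAutHol` — the group `𝒜_p` cut out by
  the Aut-holomorphic space (`germAutFromAutHol`, = `germAut p` by `cor27eGermAutFromAutHol_holds`) consists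
  of the germs `z ↦ p + c (z − p)`, `c ∈ ℂ^×`, at EVERY point of EVERY disc; so the transport of (e) along
  `φ` is "the element of the same multiplier" — which IS the conjugate of the affine representative by `φ`
  up to first order (abc-iut-w4-d104 `hasDerivAt_conj_mulAffine`, `hasDerivAt_writtenInExtChartAt_conj_mulAffine`:
  the conjugate has derivative `c` at `φ p`), i.e. the induced `𝒜_p ∪ {0} ⥲ 𝒜_{φ p} ∪ {0}` is the identity
  on multipliers (`Cor27f.germAutTrans_mem_transport`: it is abc-iut-w4-d104's `germAutTrans`).

HONEST SCOPE: MODEL LEVEL (planar Aut-holomorphic discs; the finite étale map enters only through its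
derivative at `p`); the orbispace-level (f) and the genuine-`𝔼` group law are abc-iut-w6-d031's /
abc-iut-w5-d208's rows.  Refereed pre-IUT material; nothing here bears on the disputed [IUTchIII] Cor. 3.12;
typed ≠ endorsed.
-/

noncomputable section

namespace Literature.AnabelianGeometry.AbsoluteAnabelian

open _root_.TopologicalSpace _root_.Topology _root_.Set _root_.Metric _root_.Function _root_.Filter
open scoped _root_.Manifold _root_.ContDiff ComplexConjugate UpperHalfPlane MatrixGroups InnerProductSpace
open _root_.UpperHalfPlane Literature.Analysis.Complex NormedSpace _root_.Complex
open scoped Matrix.Norms.Operator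

set_option backward.isDefEq.respectTransparency false

namespace Cor27e

variable (V : Opens ℂ)

/-! ### The frames of (d): the complete description -/

/-- The degenerate pair `(0, 0)` is a frame of (d) (the trivial one-parameter subgroup has a constant
orbit; an order-four stabiliser element exists by `exists_orderFour_stabilizer`).
[cite: MochizukiAbsTopIII2015, Corollary 2.7 (d) p.59] -/
theorem zero_mem_autHolOrthFramesAt (hV : IsAutHolDisc V) (p : V) :
    ((0 : ℂ), (0 : ℂ)) ∈ autHolOrthFramesAt V p := by
  letI := homeoCompactOpen (⊤ : Opens V)
  obtain ⟨k, hkp, hk4, hk2⟩ := exists_orderFour_stabilizer V hV p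
  refine ⟨1, k, 1, 1, continuous_const, hkp, hk4, hk2, one_pos, one_pos, ?_, ?_⟩
  · simp only [MonoidHom.one_apply, Subgroup.coe_one, Homeomorph.one_apply, deriv_const, mul_zero]
  · simp only [MonoidHom.one_apply, mul_one, mul_inv_cancel, Subgroup.coe_one, Homeomorph.one_apply,
      deriv_const, mul_zero]

/-- **The frames of (d) at `p`, completely described**: a pair of vectors is a frame of Cor 2.7 (d)
(tangent to `S₁ · p` and `(k S₁ k⁻¹) · p`) iff it is `(0, 0)` or a pair of NON-ZERO ORTHOGONAL vectors —
at every point of every planar Aut-holomorphic disc. [cite: MochizukiAbsTopIII2015, Corollary 2.7 (d) p.59] -/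
theorem mem_autHolOrthFramesAt_iff (hV : IsAutHolDisc V) (p : V) (e : ℂ × ℂ) :
    e ∈ autHolOrthFramesAt V p ↔
      (e.1 = 0 ∧ e.2 = 0) ∨ (e.1 ≠ 0 ∧ e.2 ≠ 0 ∧ ⟪e.1, e.2⟫_ℝ = 0) := by
  constructor
  · intro he
    by_cases h1 : e.1 = 0
    · exact Or.inl ⟨h1, (fst_eq_zero_iff_snd_eq_zero_of_mem V hV p he).1 h1⟩
    · exact Or.inr ⟨h1, fun h2 => h1 ((fst_eq_zero_iff_snd_eq_zero_of_mem V hV p he).2 h2),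
        inner_eq_zero_of_mem_autHolOrthFramesAt V hV p he⟩
  · rintro (⟨h1, h2⟩ | ⟨h1, h2, h12⟩)
    · have : e = ((0 : ℂ), (0 : ℂ)) := Prod.ext h1 h2
      rw [this]; exact zero_mem_autHolOrthFramesAt V hV p
    · have : e = (e.1, e.2) := rfl
      rw [this]; exact mem_autHolOrthFramesAt_of_inner_eq_zero V hV p h1 h2 h12

end Cor27e

namespace Cor27f

/-! ### (d) is functorial along finite étale maps: the derivative carries frames onto frames -/

/-- **Any complex similarity carries the frames of (d) onto the frames of (d)** — across ANY two planar
Aut-holomorphic discs and base points: for `c ≠ 0`, `(e₁, e₂) ↦ (c e₁, c e₂)` maps `autHolOrthFramesAt V p`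
onto `autHolOrthFramesAt V' p'` (both are `{(0,0)} ∪ {non-zero orthogonal pairs}`).
[cite: MochizukiAbsTopIII2015, Corollary 2.7 (f) p.60] -/
theorem image_mul_autHolOrthFramesAt {V V' : Opens ℂ} (hV : IsAutHolDisc V) (hV' : IsAutHolDisc V')
    (p : V) (p' : V') {c : ℂ} (hc : c ≠ 0) :
    (fun e : ℂ × ℂ => (c * e.1, c * e.2)) '' autHolOrthFramesAt V p = autHolOrthFramesAt V' p' := by
  ext e
  rw [Set.mem_image, Cor27e.mem_autHolOrthFramesAt_iff V' hV' p' e]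
  constructor
  · rintro ⟨e₀, he₀, rfl⟩
    rcases (Cor27e.mem_autHolOrthFramesAt_iff V hV p e₀).1 he₀ with ⟨h1, h2⟩ | ⟨h1, h2, h12⟩
    · exact Or.inl ⟨by simp [h1], by simp [h2]⟩
    · exact Or.inr ⟨mul_ne_zero hc h1, mul_ne_zero hc h2, by
        show ⟪c * e₀.1, c * e₀.2⟫_ℝ = 0
        rw [inner_mul_left_mul_left, h12, mul_zero]⟩
  · intro he
    refine ⟨(c⁻¹ * e.1, c⁻¹ * e.2), ?_, by ext <;> simp [mul_inv_cancel_left₀ hc]⟩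
    rw [Cor27e.mem_autHolOrthFramesAt_iff V hV p]
    rcases he with ⟨h1, h2⟩ | ⟨h1, h2, h12⟩
    · exact Or.inl ⟨by simp [h1], by simp [h2]⟩
    · exact Or.inr ⟨mul_ne_zero (inv_ne_zero hc) h1, mul_ne_zero (inv_ne_zero hc) h2, by
        show ⟪c⁻¹ * e.1, c⁻¹ * e.2⟫_ℝ = 0
        rw [inner_mul_left_mul_left, h12, mul_zero]⟩

/-- **[AbsTopIII] Cor 2.7 (f) for (d), at the germ model**: along a map `φ` with `HasDerivAt φ d p`,
`d ≠ 0` — a holomorphic finite étale morphism, i.e. a holomorphic local isomorphism, read in the plane —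
the derivative `e ↦ (d e₁, d e₂)` carries the frames of (d) at `p ∈ V` ONTO the frames of (d) at
`φ p ∈ V'` (for any planar Aut-holomorphic discs `V ∋ p`, `V' ∋ φ p`), although `φ` induces no map of
one-parameter subgroups `Aut^hol(V) → Aut^hol(V')`. [cite: MochizukiAbsTopIII2015, Corollary 2.7 (f) p.60] -/
theorem autHolOrthFramesAt_transport_of_hasDerivAt {V V' : Opens ℂ} (hV : IsAutHolDisc V)
    (hV' : IsAutHolDisc V') (p : V) {φ : ℂ → ℂ} {d : ℂ} (_hφ : HasDerivAt φ d p) (hd : d ≠ 0)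
    (hp' : φ p ∈ (V' : Set ℂ)) :
    (fun e : ℂ × ℂ => (d * e.1, d * e.2)) '' autHolOrthFramesAt V p = autHolOrthFramesAt V' ⟨φ p, hp'⟩ :=
  image_mul_autHolOrthFramesAt hV hV' p ⟨φ p, hp'⟩ hd

/-- The derivative of a map with a differentiable local left inverse is non-zero (the situation of a
finite étale map near a point; chain rule), so `autHolOrthFramesAt_transport_of_hasDerivAt` applies.
[cite: MochizukiAbsTopIII2015, Corollary 2.7 (f) p.60] -/
theorem deriv_ne_zero_of_localInverse {φ ψ : ℂ → ℂ} {p d d' : ℂ} (hφ : HasDerivAt φ d p)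
    (hψ : HasDerivAt ψ d' (φ p)) (hψφ : ∀ᶠ z in 𝓝 p, ψ (φ z) = z) : d ≠ 0 := by
  have hcomp : HasDerivAt (ψ ∘ φ) (d' * d) p := hψ.comp p hφ
  have hid : HasDerivAt (ψ ∘ φ) 1 p :=
    (hasDerivAt_id p).congr_of_eventuallyEq (hψφ.mono fun z hz => by simp [hz])
  have h := hcomp.unique hid
  intro h0
  rw [h0, mul_zero] at h
  exact zero_ne_one h

/-! ### (e) is functorial along finite étale maps: "same multiplier" -/

open LocGerm in
/-- **The group `𝒜_p` cut out by the Aut-holomorphic space consists of the germs `z ↦ p + c (z − p)`**,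
`c ∈ ℂ^×`, at every point of every planar Aut-holomorphic disc (`cor27eGermAutFromAutHol_holds` +
abc-iut-w4-d104's rigidity `mem_germAut_iff`). [cite: MochizukiAbsTopIII2015, Corollary 2.7 (e) p.60] -/
theorem mem_germAutFromAutHol_iff {V : Opens ℂ} (hV : IsAutHolDisc V) (p : V) (u : (LocGerm (p : ℂ))ˣ) :
    u ∈ germAutFromAutHol V p ↔ ∃ c : ℂˣ, u = mulUnit (p : ℂ) c := by
  rw [cor27eGermAutFromAutHol_holds V hV p, SetLike.mem_coe, mem_germAut_iff]

open LocGerm in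
/-- **[AbsTopIII] Cor 2.7 (f) for (e), at the germ model — "same multiplier"**: for planar Aut-holomorphic
discs `V ∋ p`, `V' ∋ p'` (e.g. `p' = φ p` for a holomorphic finite étale `φ`) and every `c ∈ ℂ^×`, the
germ of multiplier `c` lies in the `𝕏`-cut-out group at `p` and the germ of the SAME multiplier lies in the
`𝕏'`-cut-out group at `p'`; by abc-iut-w4-d104's `hasDerivAt_conj_mulAffine` the latter is, to first
order, the conjugate of the former by `φ` — so the induced `𝒜_p ∪ {0} ⥲ 𝒜_{p'} ∪ {0}` is the identity on
multipliers. [cite: MochizukiAbsTopIII2015, Corollary 2.7 (f) p.60] -/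
theorem mulUnit_mem_germAutFromAutHol {V V' : Opens ℂ} (hV : IsAutHolDisc V) (hV' : IsAutHolDisc V')
    (p : V) (p' : V') (c : ℂˣ) :
    mulUnit (p : ℂ) c ∈ germAutFromAutHol V p ∧ mulUnit (p' : ℂ) c ∈ germAutFromAutHol V' p' :=
  ⟨(mem_germAutFromAutHol_iff hV p _).2 ⟨c, rfl⟩, (mem_germAutFromAutHol_iff hV' p' _).2 ⟨c, rfl⟩⟩

/-- **The transport of (e) IS abc-iut-w4-d104's `germAutTrans`** ("same multiplier", Prop 2.6 (b) /
GAP-LEDGER G-w5d226-1): for `u ∈ 𝒜_p` (an element of `germAut p`, = the `𝕏`-cut-out group by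
`cor27eGermAutFromAutHol_holds`), `germAutTrans p p' u` lies in the `𝕏'`-cut-out group at `p'` and has the
same multiplier: `(germAutIsoUnits p').symm (germAutTrans p p' u) = (germAutIsoUnits p).symm u`.
[cite: MochizukiAbsTopIII2015, Corollary 2.7 (f) p.60] -/
theorem germAutTrans_mem_transport {V V' : Opens ℂ} (hV' : IsAutHolDisc V') (p : V) (p' : V')
    (u : germAut (p : ℂ)) :
    ((germAutTrans (p : ℂ) (p' : ℂ) u : germAut (p' : ℂ)) : (LocGerm (p' : ℂ))ˣ) ∈ germAutFromAutHol V' p' ∧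
      (germAutIsoUnits (p' : ℂ)).symm (germAutTrans (p : ℂ) (p' : ℂ) u) = (germAutIsoUnits (p : ℂ)).symm u := by
  refine ⟨?_, ?_⟩
  · rw [cor27eGermAutFromAutHol_holds V' hV' p']
    exact (germAutTrans (p : ℂ) (p' : ℂ) u).2
  · simp [germAutTrans]

end Cor27f

end Literature.AnabelianGeometry.AbsoluteAnabelian

end
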